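import Summits.Ventures.Crystal3D.Theorems.StickyWulffConstantCoaxialWallLawTwinTwinDichotomyModel
import Summits.Ventures.Crystal3D.Theorems.StickyWulffConstantCoaxialWallLawTwinReaderRigidity
import Summits.Ventures.Crystal3D.Theorems.StickyWulffConstantCoaxialWallLawDozenCongr
import Summits.Ventures.Crystal3D.Theorems.StickyWulffConstantGenericWallFloorStackWalkStarExclusion
import HarnessLib

/-!
# Sticky Wulff constant — coaxial wall law, T5b: the TWIN–TWIN DICHOTOMY, part 2 (kernel proof)

Support file for `stmt-Ventures-19481` (lane F 'Certificates', T5b reader-lattice graph; cf-p1 (ccxv)(A), (ccxx)).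
**`TailResidue.TwinTwinDichotomy` holds**: two ADJACENT twin readers `q₁`, `q₂` of a `1`-separated configuration have
the same twin axis (`m₂ = ±m₁`) or form the Σ9 twin-reader pair (`TailResidue.Sigma9TwinPairOwn`, in one of the two
orders).  Part 1 (`…TwinTwinDichotomyModel`) settled the model case (both readers in the model frame `L`) by a kernel
`decide` table and proved twin duality; here:

* §6 transport bookkeeping (cell isometries, conjugated reflections, pull-back of the Σ9 pair);
* §7 the four lattice-sharing shapes of `movedFcc_eq_of_isTwinReading_adjacent` (own/own, mirror/own, own/mirror,
  mirror/mirror) reduced to the model case by transport, duality and swapping — `twinTwinDichotomy`.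
-/

noncomputable section

namespace Summit.Ventures.Crystal3D.Theorems

namespace EndRowFloor

open Summit.Ventures.Crystal3D Finset NearIdentity TailResidue
open scoped InnerProductSpace

variable {X : Finset (EuclideanSpace ℝ (Fin 3))}

/-! ### §6 Transport bookkeeping -/

section Wrapper

open Literature.MathematicalPhysics.StatisticalMechanics (fccStacking)

/-- `P 0 = 0`. -/
theorem P_zero : P 0 = 0 := by
  have : ipt 0 = 0 := by ext j; simp [ipt_apply]
  rw [P, this, map_zero]

/-- `1`-separation transports along a cell isometry. -/
theorem sep_image_cellIso (hX : ∀ p ∈ X, ∀ q ∈ X, p ≠ q → 1 ≤ dist p q)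
    (S : EuclideanSpace ℝ (Fin 3) ≃ₗᵢ[ℝ] EuclideanSpace ℝ (Fin 3)) (c : EuclideanSpace ℝ (Fin 3)) :
    ∀ p ∈ X.image (fun x => S x + c), ∀ q ∈ X.image (fun x => S x + c), p ≠ q → 1 ≤ dist p q := by
  classical
  intro p hp q hq hne
  obtain ⟨x, hx, rfl⟩ := mem_image.1 hp
  obtain ⟨y, hy, rfl⟩ := mem_image.1 hq
  have hxy : x ≠ y := fun h => hne (by rw [h])
  rw [dist_add_right, LinearIsometryEquiv.dist_map]
  exact hX x hx y hy hxy

/-- Conjugating a unit reflection by an isometry. -/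
theorem map_reflection_unit (S : EuclideanSpace ℝ (Fin 3) ≃ₗᵢ[ℝ] EuclideanSpace ℝ (Fin 3)) {m : EuclideanSpace ℝ (Fin 3)}
    (hm : ‖m‖ = 1) (y : EuclideanSpace ℝ (Fin 3)) :
    S ((ℝ ∙ m)ᗮ.reflection y) = (ℝ ∙ S m)ᗮ.reflection (S y) := by
  rw [reflection_unit_apply hm, reflection_unit_apply (by rw [LinearIsometryEquiv.norm_map, hm]), map_sub,
    LinearIsometryEquiv.map_smul, LinearIsometryEquiv.inner_map_map]

/-- Lattice images compose: `(G ∘ T)·Λ = T '' (G·Λ)`. -/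
theorem image_trans_eq (G T : EuclideanSpace ℝ (Fin 3) ≃ₗᵢ[ℝ] EuclideanSpace ℝ (Fin 3)) (A : Set (EuclideanSpace ℝ (Fin 3))) :
    (G.trans T) '' A = T '' (G '' A) := by
  rw [LinearIsometryEquiv.coe_trans, Set.image_comp]

/-- Pulling the own-form Σ9 pair back along a cell isometry. -/
theorem sigma9TwinPairOwn_of_transport (S : EuclideanSpace ℝ (Fin 3) ≃ₗᵢ[ℝ] EuclideanSpace ℝ (Fin 3))
    (c : EuclideanSpace ℝ (Fin 3)) {p q : EuclideanSpace ℝ (Fin 3)}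
    (h : Sigma9TwinPairOwn (X.image fun x => S x + c) (S p + c) (S q + c)) : Sigma9TwinPairOwn X p q := by
  obtain ⟨G, n₁, n₂, w, r₁, r₂, hnn, hw, hneg, hpos, hq⟩ := h
  have hG : (G.trans S.symm).trans S = G := by
    refine LinearIsometryEquiv.ext fun x => ?_
    simp
  have t₁ : IsTwinReading X (G.trans S.symm) (S.symm n₁) p := by
    rw [← isTwinReading_transport_iff S c, hG, LinearIsometryEquiv.apply_symm_apply]; exact r₁
  have t₂ : IsTwinReading X (G.trans S.symm) (S.symm n₂) q := by
    rw [← isTwinReading_transport_iff S c, hG, LinearIsometryEquiv.apply_symm_apply]; exact r₂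
  refine ⟨G.trans S.symm, S.symm n₁, S.symm n₂, w, t₁, t₂, by rwa [LinearIsometryEquiv.inner_map_map], hw, ?_, ?_, ?_⟩
  · rwa [LinearIsometryEquiv.trans_apply, LinearIsometryEquiv.inner_map_map]
  · rwa [LinearIsometryEquiv.trans_apply, LinearIsometryEquiv.inner_map_map]
  · have : S q = S p + G w := by
      calc S q = S q + c - c := by abel
        _ = S p + c + G w - c := by rw [hq]
        _ = S p + G w := by abel
    apply S.injective
    rw [map_add, LinearIsometryEquiv.trans_apply, LinearIsometryEquiv.apply_symm_apply, this]

/-! ### §7 The dichotomy -/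

/-- **SHAPES (a)/(b)**: the second reader's own lattice is the first reader's own or mirror lattice. -/
theorem twinTwin_of_ownLattice (hX : ∀ p ∈ X, ∀ q ∈ X, p ≠ q → 1 ≤ dist p q)
    {G₁ G₂ : EuclideanSpace ℝ (Fin 3) ≃ₗᵢ[ℝ] EuclideanSpace ℝ (Fin 3)} {m₁ m₂ q₁ q₂ : EuclideanSpace ℝ (Fin 3)}
    (hq₂ : q₂ ∈ X) (h₁ : IsTwinReading X G₁ m₁ q₁) (h₂ : IsTwinReading X G₂ m₂ q₂) (hd : dist q₁ q₂ = 1)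
    (hlat : G₂ '' fccStacking 1 (Real.sqrt (2 / 3)) = G₁ '' fccStacking 1 (Real.sqrt (2 / 3)) ∨
      G₂ '' fccStacking 1 (Real.sqrt (2 / 3)) = (G₁.trans (ℝ ∙ m₁)ᗮ.reflection) '' fccStacking 1 (Real.sqrt (2 / 3))) :
    (m₂ = m₁ ∨ m₂ = -m₁) ∨ Sigma9TwinPairOwn X q₁ q₂ := by
  classical
  -- transport reader 1 to the model frame `L` at `P 0`
  set S := G₁.symm.trans L with hS
  set c := P 0 - S q₁ with hc
  have hGS : G₁.trans S = L := by
    refine LinearIsometryEquiv.ext fun x => ?_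
    simp [hS]
  have hq₁' : S q₁ + c = P 0 := by rw [hc]; abel
  set X' := X.image fun x => S x + c with hX'
  have hXs := sep_image_cellIso hX S c
  have h₁' : IsTwinReading X' L (S m₁) (P 0) := by
    have := (isTwinReading_transport_iff S c).2 h₁; rwa [hGS, hq₁'] at this
  have h₂' : IsTwinReading X' (G₂.trans S) (S m₂) (S q₂ + c) := (isTwinReading_transport_iff S c).2 h₂
  have hq₂' : S q₂ + c ∈ X' := (mem_image_cellIso_iff S c q₂).2 hq₂
  have hd' : dist (P 0) (S q₂ + c) = 1 := by rw [← hq₁', dist_add_right, LinearIsometryEquiv.dist_map, hd]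
  obtain ⟨c₁, hc₁⟩ := exists_menuOf_of_menu h₁'.1
  have hm₁ : ‖m₁‖ = 1 := h₁.1.1
  -- conclusion transport
  have back : ((S m₂ = S m₁ ∨ S m₂ = -S m₁) ∨ Sigma9TwinPairOwn X' (P 0) (S q₂ + c)) →
      (m₂ = m₁ ∨ m₂ = -m₁) ∨ Sigma9TwinPairOwn X q₁ q₂ := by
    rintro (hs | ho)
    · left
      rcases hs with hs | hs
      · exact Or.inl (S.injective hs)
      · right; apply S.injective; rw [hs, map_neg]
    · right
      rw [← hq₁'] at ho
      exact sigma9TwinPairOwn_of_transport S c ho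
  rcases hlat with hl | hl
  · -- (a) same own lattice: reader 2 has the dozen of `L`
    have hl' : (G₂.trans S) '' fccStacking 1 (Real.sqrt (2 / 3)) = L '' fccStacking 1 (Real.sqrt (2 / 3)) := by
      rw [image_trans_eq, hl, ← image_trans_eq, hGS]
    have hGG := image_fccSlots_eq_of_image_fcc_eq _ _ hl'
    have h₂'' : IsTwinReading X' L (S m₂) (S q₂ + c) := (isTwinReading_congr_dozen hGG).1 h₂'
    exact back (twinTwin_model_sameFrame hXs h₁' h₂'' hq₂' hd')
  · -- (b) reader 2's own lattice is reader 1's mirror lattice: dualize reader 1, then transport by the reflection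
    set R := (ℝ ∙ menuOf (cubeInt c₁))ᗮ.reflection with hR
    have hconj : (G₁.trans (ℝ ∙ m₁)ᗮ.reflection).trans S = L.trans R := by
      refine LinearIsometryEquiv.ext fun x => ?_
      simp only [LinearIsometryEquiv.trans_apply]
      rw [map_reflection_unit S hm₁, hc₁, hR]
      simp [hS]
    have hl' : (G₂.trans S) '' fccStacking 1 (Real.sqrt (2 / 3)) = (L.trans R) '' fccStacking 1 (Real.sqrt (2 / 3)) := by
      rw [image_trans_eq, hl, ← image_trans_eq, hconj]
    have hGG := image_fccSlots_eq_of_image_fcc_eq _ _ hl'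
    have h₂'' : IsTwinReading X' (L.trans R) (S m₂) (S q₂ + c) := (isTwinReading_congr_dozen hGG).1 h₂'
    rw [hc₁] at h₁'
    have h₁d := twin_dual hXs (u := 0) h₁'
    -- transport both by `R` (which fixes `P 0 = 0` and squares to the identity)
    have hLR : (L.trans R).trans R = L := by
      refine LinearIsometryEquiv.ext fun x => ?_
      simp only [LinearIsometryEquiv.trans_apply, hR, Submodule.reflection_reflection]
    set X'' := X'.image fun x => R x + 0 with hX''
    have hXss := sep_image_cellIso hXs R 0
    have hR0 : R (P 0) + 0 = P 0 := by rw [P_zero, map_zero, add_zero]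
    have k₁ : IsTwinReading X'' L (R (-menuOf (cubeInt c₁))) (P 0) := by
      have := (isTwinReading_transport_iff R 0).2 h₁d; rwa [hLR, hR0] at this
    have k₂ : IsTwinReading X'' L (R (S m₂)) (R (S q₂ + c) + 0) := by
      have := (isTwinReading_transport_iff R 0).2 h₂''; rwa [hLR] at this
    have hq₂'' : R (S q₂ + c) + 0 ∈ X'' := (mem_image_cellIso_iff R 0 _).2 hq₂'
    have hd'' : dist (P 0) (R (S q₂ + c) + 0) = 1 := by
      rw [← hR0, dist_add_right, LinearIsometryEquiv.dist_map, hd']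
    have res := twinTwin_model_sameFrame hXss k₁ k₂ hq₂'' hd''
    apply back
    rcases res with hs | ho
    · left
      have hRm : R (menuOf (cubeInt c₁)) = -menuOf (cubeInt c₁) := by
        rw [hR]; exact Submodule.reflection_orthogonalComplement_singleton_eq_neg _
      rw [map_neg, hRm, neg_neg, ← hc₁] at hs
      rcases hs with hs | hs
      · -- `R (S m₂) = S m₁ = - R (S m₁)`... unfold via injectivity of `R`
        right
        apply R.injective
        rw [hs, map_neg, hc₁, hRm, neg_neg]
      · left
        apply R.injective
        rw [hs, hc₁, hRm]
    · right
      rw [← hR0] at ho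
      exact sigma9TwinPairOwn_of_transport R 0 ho

/-- **SHAPE (d)**: the two readers' MIRROR lattices coincide.  Dualizing the first reader in the model turns this into
shape (b) with the roles swapped. -/
theorem twinTwin_of_mirrorLattices (hX : ∀ p ∈ X, ∀ q ∈ X, p ≠ q → 1 ≤ dist p q)
    {G₁ G₂ : EuclideanSpace ℝ (Fin 3) ≃ₗᵢ[ℝ] EuclideanSpace ℝ (Fin 3)} {m₁ m₂ q₁ q₂ : EuclideanSpace ℝ (Fin 3)}
    (hq₁ : q₁ ∈ X) (hq₂ : q₂ ∈ X) (h₁ : IsTwinReading X G₁ m₁ q₁) (h₂ : IsTwinReading X G₂ m₂ q₂) (hd : dist q₁ q₂ = 1)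
    (hlat : (G₂.trans (ℝ ∙ m₂)ᗮ.reflection) '' fccStacking 1 (Real.sqrt (2 / 3)) =
      (G₁.trans (ℝ ∙ m₁)ᗮ.reflection) '' fccStacking 1 (Real.sqrt (2 / 3))) :
    (m₂ = m₁ ∨ m₂ = -m₁) ∨ Sigma9TwinPairOwn X q₂ q₁ := by
  classical
  -- transport reader 1 to the model frame `L` at `P 0`
  set S := G₁.symm.trans L with hS
  set c := P 0 - S q₁ with hc
  have hGS : G₁.trans S = L := by
    refine LinearIsometryEquiv.ext fun x => ?_
    simp [hS]
  have hq₁' : S q₁ + c = P 0 := by rw [hc]; abel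
  set X' := X.image fun x => S x + c with hX'
  have hXs := sep_image_cellIso hX S c
  have h₁' : IsTwinReading X' L (S m₁) (P 0) := by
    have := (isTwinReading_transport_iff S c).2 h₁; rwa [hGS, hq₁'] at this
  have h₂' : IsTwinReading X' (G₂.trans S) (S m₂) (S q₂ + c) := (isTwinReading_transport_iff S c).2 h₂
  have hq₁'' : P 0 ∈ X' := by rw [← hq₁']; exact (mem_image_cellIso_iff S c q₁).2 hq₁
  have hq₂' : S q₂ + c ∈ X' := (mem_image_cellIso_iff S c q₂).2 hq₂
  have hd' : dist (P 0) (S q₂ + c) = 1 := by rw [← hq₁', dist_add_right, LinearIsometryEquiv.dist_map, hd]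
  obtain ⟨c₁, hc₁⟩ := exists_menuOf_of_menu h₁'.1
  have hm₁ : ‖m₁‖ = 1 := h₁.1.1
  have hm₂ : ‖m₂‖ = 1 := h₂.1.1
  set R := (ℝ ∙ menuOf (cubeInt c₁))ᗮ.reflection with hR
  have hRm : R (menuOf (cubeInt c₁)) = -menuOf (cubeInt c₁) := by
    rw [hR]; exact Submodule.reflection_orthogonalComplement_singleton_eq_neg _
  -- the transported lattice relation: `(G₂' ∘ R_{S m₂})·Λ = (L ∘ R)·Λ`
  have hconj₁ : (G₁.trans (ℝ ∙ m₁)ᗮ.reflection).trans S = L.trans R := by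
    refine LinearIsometryEquiv.ext fun x => ?_
    simp only [LinearIsometryEquiv.trans_apply]
    rw [map_reflection_unit S hm₁, hc₁, hR]
    simp [hS]
  have hconj₂ : (G₂.trans (ℝ ∙ m₂)ᗮ.reflection).trans S = (G₂.trans S).trans (ℝ ∙ S m₂)ᗮ.reflection := by
    refine LinearIsometryEquiv.ext fun x => ?_
    simp only [LinearIsometryEquiv.trans_apply]
    rw [map_reflection_unit S hm₂]
  have hl' : ((G₂.trans S).trans (ℝ ∙ S m₂)ᗮ.reflection) '' fccStacking 1 (Real.sqrt (2 / 3)) =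
      (L.trans R) '' fccStacking 1 (Real.sqrt (2 / 3)) := by
    rw [← hconj₂, ← hconj₁, image_trans_eq (G₂.trans _) S, image_trans_eq (G₁.trans _) S, hlat]
  -- dualize reader 1 and transport everything by `R`
  rw [hc₁] at h₁'
  have h₁d := twin_dual hXs (u := 0) h₁'
  have hLR : (L.trans R).trans R = L := by
    refine LinearIsometryEquiv.ext fun x => ?_
    simp only [LinearIsometryEquiv.trans_apply, hR, Submodule.reflection_reflection]
  set X'' := X'.image fun x => R x + 0 with hX''
  have hXss := sep_image_cellIso hXs R 0
  have hR0 : R (P 0) + 0 = P 0 := by rw [P_zero, map_zero, add_zero]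
  have k₁ : IsTwinReading X'' L (R (-menuOf (cubeInt c₁))) (P 0) := by
    have := (isTwinReading_transport_iff R 0).2 h₁d; rwa [hLR, hR0] at this
  have k₂ : IsTwinReading X'' ((G₂.trans S).trans R) (R (S m₂)) (R (S q₂ + c) + 0) :=
    (isTwinReading_transport_iff R 0).2 h₂'
  have hp₀ : P 0 ∈ X'' := by rw [← hR0]; exact (mem_image_cellIso_iff R 0 _).2 hq₁''
  have hd'' : dist (R (S q₂ + c) + 0) (P 0) = 1 := by
    rw [← hR0, dist_add_right, LinearIsometryEquiv.dist_map, dist_comm, hd']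
  -- the relation for the swapped pair: reader 1''s own lattice `L·Λ` is reader 2''s mirror lattice
  have hSm₂ : ‖S m₂‖ = 1 := by rw [LinearIsometryEquiv.norm_map, hm₂]
  have hconj₃ : ((G₂.trans S).trans (ℝ ∙ S m₂)ᗮ.reflection).trans R =
      (((G₂.trans S).trans R).trans (ℝ ∙ R (S m₂))ᗮ.reflection) := by
    refine LinearIsometryEquiv.ext fun x => ?_
    simp only [LinearIsometryEquiv.trans_apply]
    rw [map_reflection_unit R hSm₂]
  have hl'' : L '' fccStacking 1 (Real.sqrt (2 / 3)) =
      (((G₂.trans S).trans R).trans (ℝ ∙ R (S m₂))ᗮ.reflection) '' fccStacking 1 (Real.sqrt (2 / 3)) := by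
    rw [← hconj₃, image_trans_eq, hl', ← image_trans_eq, hLR]
  have res := twinTwin_of_ownLattice hXss hp₀ k₂ k₁ hd'' (Or.inr hl'')
  rcases res with hs | ho
  · left
    rw [map_neg, hRm, neg_neg, ← hc₁] at hs
    -- `S m₁ = ± R (S m₂)` with `R (S m₁) = - S m₁`
    have hRS : R (S m₁) = -S m₁ := by rw [hc₁, hRm]
    rcases hs with hs | hs
    · right
      apply S.injective
      have : S m₂ = R (S m₁) := by rw [hs, hR, Submodule.reflection_reflection]
      rw [this, hRS, map_neg]
    · left
      apply S.injective
      have : S m₂ = R (-S m₁) := by rw [hs, neg_neg, hR, Submodule.reflection_reflection]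
      rw [this, map_neg, hRS, neg_neg]
  · right
    rw [← hR0] at ho
    have ho' := sigma9TwinPairOwn_of_transport R 0 ho
    rw [← hq₁'] at ho'
    exact sigma9TwinPairOwn_of_transport S c ho'

/-- **THE TWIN–TWIN DICHOTOMY** (`TailResidue.TwinTwinDichotomy`): in a `1`-separated configuration two adjacent twin
readers have the same twin axis or form a Σ9 twin-reader pair (own form, in one of the two orders). -/
theorem twinTwinDichotomy : TwinTwinDichotomy := by
  intro X hX G₁ G₂ m₁ m₂ q₁ q₂ hq₁ hq₂ h₁ h₂ hd
  obtain ⟨A, B, hA, hB, hAB⟩ := movedFcc_eq_of_isTwinReading_adjacent hX hq₁ hq₂ h₁ h₂ hd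
  have hd' : dist q₂ q₁ = 1 := by rw [dist_comm, hd]
  rcases hA with rfl | rfl <;> rcases hB with rfl | rfl
  · -- (a)
    rcases twinTwin_of_ownLattice hX hq₂ h₁ h₂ hd (Or.inl hAB.symm) with hs | ho
    · exact Or.inl hs
    · exact Or.inr (Or.inl (Or.inl ho))
  · -- (c): reader 2's mirror lattice is reader 1's own lattice — swap the roles
    rcases twinTwin_of_ownLattice hX hq₁ h₂ h₁ hd' (Or.inr hAB) with hs | ho
    · left
      rcases hs with hs | hs
      · exact Or.inl hs.symm
      · right; rw [hs, neg_neg]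
    · exact Or.inr (Or.inr (Or.inl ho))
  · -- (b)
    rcases twinTwin_of_ownLattice hX hq₂ h₁ h₂ hd (Or.inr hAB.symm) with hs | ho
    · exact Or.inl hs
    · exact Or.inr (Or.inl (Or.inl ho))
  · -- (d): the two mirror lattices coincide
    rcases twinTwin_of_mirrorLattices hX hq₁ hq₂ h₁ h₂ hd hAB.symm with hs | ho
    · exact Or.inl hs
    · exact Or.inr (Or.inr (Or.inl ho))

end Wrapper

end EndRowFloor

/-- **`TwinTwinDichotomy` holds** (consumer-facing name). -/
theorem TailResidue.twinTwinDichotomy_holds : TailResidue.TwinTwinDichotomy := EndRowFloor.twinTwinDichotomy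

end Summit.Ventures.Crystal3D.Theorems

end
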